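import Literature.MathematicalPhysics.QuantumFieldTheory.Balaban1983to89.B15Eq177GaugeInvariance
import Literature.MathematicalPhysics.QuantumFieldTheory.Balaban1983to89.B12GaugeOrbits021

/-!
# T4 — THE ROOTED (AXIAL-TYPE) RESIDUAL GAUGE OF LEVEL `k` ON THE FINE TORUS `T_η`: coordinate-path holonomies, the rooted transporter
# `g_U(x) = hol_U(centre of B^k(x) → x)`, the normal form `U ↦ U^{g_U}` — constant on residual orbits, equivariant under block-constant lifts, measurable

Cell `pub-ymgap` (YM-PLAN Track A, node N09 = [Balaban1987RG1] Sects 2–5), seat `pub-ymgap-dag-n09-w4` (g2; D-0149 width seat), FILE 2a; helper of K1⁷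
`StabilityBAtRecordR13SepCoPH` = stmt-QuantumFields-20542 (count-neutral).  [I] = [Balaban1987RG1] (CMP 109), [B11] = [Balaban1985Variational] (CMP 102),
[B7] = [Balaban1985Averaging] (CMP 98).  Kernel certificate over the tree's own vocabulary (`Setup`: `Site`, `GaugeField`, `gaugeAct`; r13 `B16Sect1Backgrounds`;
dag-p07 `B12GaugeOrbits021`: `IsResidual`, `OrbitRel`, `gaugeAct_mul`; r15 `B15Eq177GaugeInvariance`: `blockLift`, `blockIter_embIter`; r08 `B15DeterminingSets.embIter`,
`B14.Eq22Determines.blockIter`) — used BY NAME, nothing re-declared.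

WHY.  [I] p. 256 fixes the minimiser `U_k(V)` of (0.21) only up to the RESIDUAL gauge group of level `k` («u = 1 on T⁽ᵏ⁾»); print removes the ambiguity by the
axial gauge relative to the block centres ([B11] p. 281 «exactly one gauge transformation u satisfying R̄₀uʲ = 1 on Λ_j», [B8] (1.19)–(1.20)), and for THAT selection
[B11] (181) p. 307 «U_k(V^v) = U_k(V)^{v̄}, v̄ constant on blocks B^j(y) and equal to v(y)» holds.  The programme's record (`Node00.Uk`) is a bare choice in the orbit;
its consumers at node N09 display two SELECTION properties (measurability (H-U), block-lift covariance (M1′)) that only a gauge-fixed selection has.  THIS FILE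
supplies the gauge fixing as a total, measurable, algebraically certified normal form on `T_η` — the object a re-pointed `U_k` would be read through (companion
Theorems file `Summits/…/BalabanUVNodesN09UkRootedGaugeSelector`: the rooted measurable selector of the (0.21) minimisers, (181)-covariant on the [B11] domain).
Only the TRANSFORMATION LAW of path holonomies is used (telescoping) — no smallness, no tree-bond bookkeeping, no estimate.
NOT HIERARCHICAL (v1.1 note, asked by dag-n09-w1 g2): the rooted gauge here is ONE-LEVEL — level-`0` combs to the centres of the `k`-blocks.  The partial averages
`M^j(rootGauge k U)`, `0 < j < k`, are NOT claimed axial at level `j` (no `haxbg`-type statement is a theorem for this object or for `Node00.UkSel` as they stand).  A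
HIERARCHICALLY rooted tree — `x → x₁ → … → x_k` through the intermediate block centres `x_n = embIter n (B^n x)`, [B8] (1.19)–(1.20) — is again a root-to-`x` path, so
§1's telescoping (`pathHol_gaugeAct`) and every §2 law (residual constancy, `blockLift`-equivariance, measurability) hold for it VERBATIM; it is the object a level-wise
axiality statement would address, and it is NOT built here.
ADOPTION NOTE (for the record's owner, not done here): a Literature-side re-point `U_k := rootGauge k ∘ f` needs a measurable (0.21) selector `f` importable from
Literature — node00-def-K0c's `Node00.Record12MinimiserSelection.exists_measurable_isMinimizer_selector` pattern (`exists_measurable_constrained_argmin` over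
`sigmaClosedContinuous_iter` and the open class `bgReg`) gives it in ≈ 60 lines, exactly as the Summits certificate `…BalabanUVNodesN09UkMeasurableSelector` §1 does.

WHAT IS DEFINED ∕ PROVED (0 `sorry`, 0 `instance`, 0 `notation`; v1.1 = v1 + the NOT-HIERARCHICAL note above, no declaration touched):
* §1 coordinate paths on `T^{(j)}`: `shiftN x μ n = x + n·e_μ`; the straight holonomy `lineHol`; `steps a x μ = (x_μ − a_μ).val`; the coordinate-ordered path from `a`
  aimed at `x` — end point `pathEnd`, holonomy `pathHol` — with `pathEnd_finRange` (through all `d` directions the path ENDS at `x`) and ★ TELESCOPING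
  `lineHol_gaugeAct` ∕ `pathHol_gaugeAct`: `hol_{U^u}(a → ·) = u(a)·hol_U(a → ·)·u(end)⁻¹` ([B7] (8)).
* §2 `rootOf k x = embIter k (B^k x)` (the centre of the `k`-block of `x`), the ROOTED TRANSPORTER `rootTransporter k U x = hol_U(rootOf k x → x)` and the ROOTED
  GAUGE `rootGauge k U = U^{g_U}`: `rootTransporter_gaugeAct` (`g_{U^u}(x) = u(root x)·g_U(x)·u(x)⁻¹`, every `u`), `isResidual_rootTransporter` (`g_U = 1` on `T⁽ᵏ⁾`;
  standing range `k ≤ m + K`), `orbitRel_rootGauge`, ★ `rootGauge_gaugeAct_of_isResidual` (CONSTANT on residual orbits), `rootGauge_eq_of_orbitRel`,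
  `rootGauge_rootGauge`, ★ `rootGauge_gaugeAct_blockLift` (EQUIVARIANT under `v̄ = blockLift k v`), `rootGauge_one`.
* §2b `measurable_lineHol` ∕ `measurable_pathHol` ∕ `measurable_rootTransporter_apply` ∕ ★ `measurable_rootGauge` (any `[MeasurableMul₂ G] [MeasurableInv G]`;
  `SU(N)` by `RegularGaugeGroup`).

HONEST FRAMING — what this is NOT.  Group algebra on the torus (`Function.update`, `ZMod.natCast_zmod_val`, telescoping products) and measurability of finite
products; the rooted gauge is a coordinate-path VARIANT of print's hierarchical axial gauge (same residual group, same transformation laws — the only content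
consumers use); NOTHING of Bałaban's asserted; no estimate; no carrier of any record re-pointed; counts of the `pub-ymgap` DAG unmoved; one finite torus at a
time — NOT continuum ∕ ℝ⁴ ∕ OS; the YM mass gap (Clay) is NOT proved by any of this.
-/

noncomputable section

namespace Literature.MathematicalPhysics.QuantumFieldTheory.Balaban1983to89.T4RootedResidualGauge

open _root_.MeasureTheory Set
open B12GaugeOrbits021 (OrbitRel IsResidual gaugeAct_mul)
open B15DeterminingSets (embIter)
open B14.Eq22Determines (blockIter)
open B15Eq177GaugeInvariance (blockLift blockIter_embIter)
open B12RTGaugeInvariance254 (gaugeAct_one')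
open GaugeField (gaugeAct)

/-! ## §1  Coordinate paths on the torus and their holonomies -/

section Paths

variable {P : Params} {j : ℕ} {G : Type*} [GaugeGroup G]

/-- `x + n·e_μ` on the torus `T^{(j)}`. [cite: Balaban1985Averaging, (8) p.19 (bookkeeping)] -/
def shiftN (x : Site P j) (μ : Fin P.d) (n : ℕ) : Site P j := Function.update x μ (x μ + n)

omit [GaugeGroup G] in
/-- `x + 0·e_μ = x`. [cite: Balaban1985Averaging, (8) p.19 (bookkeeping)] -/
@[simp] theorem shiftN_zero (x : Site P j) (μ : Fin P.d) : shiftN x μ 0 = x := by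
  simp [shiftN]

omit [GaugeGroup G] in
/-- `x + (n+1)·e_μ = (x + n·e_μ) + e_μ`. [cite: Balaban1985Averaging, (8) p.19 (bookkeeping)] -/
theorem shiftN_succ (x : Site P j) (μ : Fin P.d) (n : ℕ) : shiftN x μ (n + 1) = (shiftN x μ n).shift μ := by
  unfold shiftN Site.shift
  rw [Function.update_idem, Function.update_self]
  congr 1
  push_cast
  ring

/-- The holonomy of `U` along the straight path `a, a + e_μ, …, a + n·e_μ` (ordered product of the bond variables). [cite: Balaban1985Averaging, (8) p.19 (bookkeeping)] -/
def lineHol (U : GaugeField P j G) (a : Site P j) (μ : Fin P.d) : ℕ → G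
  | 0 => 1
  | n + 1 => lineHol U a μ n * U ⟨shiftN a μ n, μ⟩

/-- `lineHol … 0 = 1`. [cite: Balaban1985Averaging, (8) p.19 (bookkeeping)] -/
@[simp] theorem lineHol_zero (U : GaugeField P j G) (a : Site P j) (μ : Fin P.d) : lineHol U a μ 0 = 1 := rfl

/-- One more step. [cite: Balaban1985Averaging, (8) p.19 (bookkeeping)] -/
theorem lineHol_succ (U : GaugeField P j G) (a : Site P j) (μ : Fin P.d) (n : ℕ) :
    lineHol U a μ (n + 1) = lineHol U a μ n * U ⟨shiftN a μ n, μ⟩ := rfl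

/-- The unit configuration has trivial holonomies. [cite: Balaban1985Averaging, (8) p.19 (bookkeeping)] -/
@[simp] theorem lineHol_one (a : Site P j) (μ : Fin P.d) (n : ℕ) : lineHol (1 : GaugeField P j G) a μ n = 1 := by
  induction n with
  | zero => rfl
  | succ n ih => rw [lineHol_succ, ih, one_mul]; rfl

/-- **TELESCOPING ALONG A LINE**: `hol_{U^u}(a → a + n e_μ) = u(a) · hol_U(a → a + n e_μ) · u(a + n e_μ)⁻¹` ([B7] (8): `U^u(x,x') = u(x)U(x,x')u(x')⁻¹`).
[cite: Balaban1985Averaging, (8) p.19] -/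
theorem lineHol_gaugeAct (u : GaugeTransf P j G) (U : GaugeField P j G) (a : Site P j) (μ : Fin P.d) (n : ℕ) :
    lineHol (gaugeAct u U) a μ n = u a * lineHol U a μ n * (u (shiftN a μ n))⁻¹ := by
  induction n with
  | zero => simp
  | succ n ih =>
      rw [lineHol_succ, lineHol_succ, ih, shiftN_succ]
      show u a * lineHol U a μ n * (u (shiftN a μ n))⁻¹ * (u (shiftN a μ n) * U ⟨shiftN a μ n, μ⟩ * (u ((shiftN a μ n).shift μ))⁻¹) = _
      simp only [mul_assoc, inv_mul_cancel_left]

/-- The number of `+e_μ` steps from `a` to the `μ`-coordinate of `x` (around the torus). [cite: Balaban1985Averaging, (8) p.19 (bookkeeping)] -/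
def steps (a x : Site P j) (μ : Fin P.d) : ℕ := (x μ - a μ).val

omit [GaugeGroup G] in
/-- After `steps a x μ` steps along `e_μ` the `μ`-coordinate IS `x μ` (and the others are unchanged). [cite: Balaban1985Averaging, (8) p.19 (bookkeeping)] -/
theorem shiftN_steps_apply (a x : Site P j) (μ ν : Fin P.d) :
    shiftN a μ (steps a x μ) ν = if ν = μ then x μ else a ν := by
  unfold shiftN steps
  by_cases h : ν = μ
  · subst h
    rw [Function.update_self, if_pos rfl, ZMod.natCast_zmod_val]
    abel
  · rw [Function.update_of_ne h, if_neg h]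

/-- The end point of the coordinate-ordered path from `a` aimed at `x` through the directions of the list `l`. [cite: Balaban1985Averaging, (8) p.19 (bookkeeping)] -/
def pathEnd : Site P j → Site P j → List (Fin P.d) → Site P j
  | a, _, [] => a
  | a, x, μ :: l => pathEnd (shiftN a μ (steps a x μ)) x l

/-- The holonomy of `U` along the coordinate-ordered path from `a` aimed at `x` through the directions of `l` (direction `μ` first: `steps a x μ` steps
along `+e_μ`, then the rest from the point reached). [cite: Balaban1985Averaging, (8) p.19 (bookkeeping)] -/
def pathHol (U : GaugeField P j G) : Site P j → Site P j → List (Fin P.d) → G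
  | _, _, [] => 1
  | a, x, μ :: l => lineHol U a μ (steps a x μ) * pathHol U (shiftN a μ (steps a x μ)) x l

omit [GaugeGroup G] in
/-- The end point through a duplicate-free list of directions: the coordinates in the list are those of `x`, the others those of `a`. [cite: Balaban1985Averaging, (8) p.19 (bookkeeping)] -/
theorem pathEnd_apply_of_nodup : ∀ (a x : Site P j) (l : List (Fin P.d)), l.Nodup → ∀ ν, pathEnd a x l ν = if ν ∈ l then x ν else a ν
  | a, x, [], _, ν => by simp [pathEnd]
  | a, x, μ :: l, hl, ν => by
      rw [List.nodup_cons] at hl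
      rw [pathEnd, pathEnd_apply_of_nodup _ x l hl.2 ν, shiftN_steps_apply]
      by_cases hν : ν ∈ l
      · have hνμ : ν ≠ μ := fun h => hl.1 (h ▸ hν)
        simp [hν]
      · by_cases hνμ : ν = μ
        · subst hνμ; simp [hν]
        · simp [hν, hνμ]

omit [GaugeGroup G] in
/-- **THE FULL COORDINATE PATH ENDS AT ITS TARGET**: through all `d` directions the path from `a` aimed at `x` ends at `x`. [cite: Balaban1985Averaging, (8) p.19 (bookkeeping)] -/
theorem pathEnd_finRange (a x : Site P j) : pathEnd a x (List.finRange P.d) = x := by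
  funext ν
  rw [pathEnd_apply_of_nodup a x _ (List.nodup_finRange P.d) ν, if_pos (List.mem_finRange ν)]

/-- The unit configuration has trivial path holonomies. [cite: Balaban1985Averaging, (8) p.19 (bookkeeping)] -/
@[simp] theorem pathHol_one : ∀ (a x : Site P j) (l : List (Fin P.d)), pathHol (1 : GaugeField P j G) a x l = 1
  | _, _, [] => rfl
  | a, x, μ :: l => by rw [pathHol, lineHol_one, pathHol_one, one_mul]

/-- The path from `x` aimed at `x` is trivial (every `steps x x μ = 0`). [cite: Balaban1985Averaging, (8) p.19 (bookkeeping)] -/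
theorem pathHol_self : ∀ (U : GaugeField P j G) (x : Site P j) (l : List (Fin P.d)), pathHol U x x l = 1
  | U, x, [] => rfl
  | U, x, μ :: l => by
      have h0 : steps x x μ = 0 := by simp [steps]
      rw [pathHol, h0, lineHol_zero, shiftN_zero, pathHol_self U x l, one_mul]

/-- **★ TELESCOPING ALONG A PATH**: `hol_{U^u}(a → x) = u(a) · hol_U(a → x) · u(end)⁻¹`. [cite: Balaban1985Averaging, (8) p.19] -/
theorem pathHol_gaugeAct (u : GaugeTransf P j G) (U : GaugeField P j G) :
    ∀ (a x : Site P j) (l : List (Fin P.d)), pathHol (gaugeAct u U) a x l = u a * pathHol U a x l * (u (pathEnd a x l))⁻¹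
  | a, x, [] => by simp [pathHol, pathEnd]
  | a, x, μ :: l => by
      rw [pathHol, pathHol, pathEnd, lineHol_gaugeAct, pathHol_gaugeAct u U _ x l]
      simp only [mul_assoc, inv_mul_cancel_left]

end Paths

/-! ## §2  The rooted transporter and the rooted (axial-type) residual gauge of level `k` on `T_η` -/

section Rooted

variable {P : Params} {G : Type*} [GaugeGroup G]

/-- The ROOT of a fine site at level `k`: the centre `embIter k (B^k x) ∈ T⁽ᵏ⁾ ⊂ T_η` of its `k`-block ([I] p. 251 «lattice of centers»).
[cite: Balaban1987RG1, (0.1) p.251] -/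
def rootOf (k : ℕ) (x : Site P 0) : Site P 0 := embIter k (blockIter k x)

omit [GaugeGroup G] in
/-- A centre is its own root (standing range `k ≤ m + K`; r15 `blockIter_embIter`). [cite: Balaban1985Variational, (181) p.307 (bookkeeping)] -/
theorem rootOf_embIter {k : ℕ} (hk : k ≤ P.m + P.K) (y : Site P k) : rootOf k (embIter k y : Site P 0) = embIter k y := by
  unfold rootOf
  rw [blockIter_embIter k hk]

omit [GaugeGroup G] in
/-- The root of `x` lies in the `k`-block of `x`: `B^k(root x) = B^k x` (standing range). [cite: Balaban1985Variational, (181) p.307 (bookkeeping)] -/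
theorem blockIter_rootOf {k : ℕ} (hk : k ≤ P.m + P.K) (x : Site P 0) : blockIter k (rootOf k x) = blockIter k x := by
  unfold rootOf
  rw [blockIter_embIter k hk]

/-- **THE ROOTED TRANSPORTER** `g_U(x)` = the holonomy of `U` along the coordinate path from the root of `x` to `x` — the gauge transformation that
brings `U` to the axial-type gauge relative to the block centres ([B11] p. 281: «exactly one gauge transformation u satisfying R̄₀uʲ = 1 on Λ_j»; here the
coordinate-path variant, used only through its transformation law). [cite: Balaban1985Variational, (19) p.281] -/
def rootTransporter (k : ℕ) (U : GaugeField P 0 G) : GaugeTransf P 0 G := fun x => pathHol U (rootOf k x) x (List.finRange P.d)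

/-- **THE ROOTED GAUGE** `U ↦ U^{g_U}` (a normal form for the residual gauge group of level `k`). [cite: Balaban1985Variational, (19) p.281] -/
def rootGauge (k : ℕ) (U : GaugeField P 0 G) : GaugeField P 0 G := gaugeAct (rootTransporter k U) U

/-- **COVARIANCE OF THE TRANSPORTER**: `g_{U^u}(x) = u(root x) · g_U(x) · u(x)⁻¹` for EVERY gauge transformation `u` (telescoping; the path ends at `x`).
[cite: Balaban1985Averaging, (8) p.19] -/
theorem rootTransporter_gaugeAct (k : ℕ) (u : GaugeTransf P 0 G) (U : GaugeField P 0 G) (x : Site P 0) :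
    rootTransporter k (gaugeAct u U) x = u (rootOf k x) * rootTransporter k U x * (u x)⁻¹ := by
  unfold rootTransporter
  rw [pathHol_gaugeAct, pathEnd_finRange]

/-- At a centre the transporter is trivial (empty path). [cite: Balaban1985Variational, (19) p.281 (bookkeeping)] -/
theorem rootTransporter_embIter {k : ℕ} (hk : k ≤ P.m + P.K) (U : GaugeField P 0 G) (y : Site P k) :
    rootTransporter k U (embIter k y) = 1 := by
  unfold rootTransporter
  rw [rootOf_embIter hk, pathHol_self]

/-- **`g_U` IS RESIDUAL OF LEVEL `k`** («u = 1 on T⁽ᵏ⁾», [I] p. 256): the rooted gauge moves `U` inside its residual orbit. [cite: Balaban1987RG1, (0.21) p.256] -/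
theorem isResidual_rootTransporter {k : ℕ} (hk : k ≤ P.m + P.K) (U : GaugeField P 0 G) : IsResidual k (rootTransporter k U) :=
  fun y => rootTransporter_embIter hk U y

/-- The rooted gauge of `U` lies in the residual orbit of `U`. [cite: Balaban1987RG1, (0.21) p.256] -/
theorem orbitRel_rootGauge {k : ℕ} (hk : k ≤ P.m + P.K) (U : GaugeField P 0 G) : OrbitRel k U (rootGauge k U) :=
  ⟨rootTransporter k U, isResidual_rootTransporter hk U, rfl⟩

/-- The unit configuration is its own rooted gauge. [cite: Balaban1985Variational, (19) p.281 (bookkeeping)] -/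
theorem rootTransporter_one (k : ℕ) : rootTransporter k (1 : GaugeField P 0 G) = fun _ => 1 := by
  funext x
  exact pathHol_one _ _ _

/-- `rootGauge k 1 = 1`. [cite: Balaban1985Variational, (19) p.281 (bookkeeping)] -/
theorem rootGauge_one (k : ℕ) : rootGauge k (1 : GaugeField P 0 G) = 1 := by
  unfold rootGauge
  rw [rootTransporter_one]
  exact gaugeAct_one' _

/-- **★ THE ROOTED GAUGE IS CONSTANT ON RESIDUAL ORBITS**: `(U^u)^{g_{U^u}} = U^{g_U}` for `u = 1` on `T⁽ᵏ⁾` (`g_{U^u} = g_U·u⁻¹` pointwise, since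
`u(root x) = 1`). [cite: Balaban1987RG1, (0.21) p.256; Balaban1985Variational, (19) p.281] -/
theorem rootGauge_gaugeAct_of_isResidual {k : ℕ} {u : GaugeTransf P 0 G} (hu : IsResidual k u) (U : GaugeField P 0 G) :
    rootGauge k (gaugeAct u U) = rootGauge k U := by
  unfold rootGauge
  rw [← gaugeAct_mul]
  congr 1
  funext x
  show rootTransporter k (gaugeAct u U) x * u x = rootTransporter k U x
  rw [rootTransporter_gaugeAct, show u (rootOf k x) = 1 from hu (blockIter k x), one_mul, inv_mul_cancel_right]

/-- Two configurations in one residual orbit have the SAME rooted gauge. [cite: Balaban1987RG1, (0.21) p.256] -/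
theorem rootGauge_eq_of_orbitRel {k : ℕ} {U U' : GaugeField P 0 G} (h : OrbitRel k U U') : rootGauge k U' = rootGauge k U := by
  obtain ⟨u, hu, rfl⟩ := h
  exact rootGauge_gaugeAct_of_isResidual hu U

/-- The rooted gauge is idempotent (standing range). [cite: Balaban1985Variational, (19) p.281 (bookkeeping)] -/
theorem rootGauge_rootGauge {k : ℕ} (hk : k ≤ P.m + P.K) (U : GaugeField P 0 G) : rootGauge k (rootGauge k U) = rootGauge k U :=
  rootGauge_eq_of_orbitRel (orbitRel_rootGauge hk U)

/-- **★ EQUIVARIANCE UNDER BLOCK-CONSTANT LIFTS** ([B11] (181) «v̄ is constant on blocks B^j(y) … and equal to v(y)»): for `v̄ = blockLift k v`,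
`(U^{v̄})^{g_{U^{v̄}}} = (U^{g_U})^{v̄}` — the root of `x` lies in the block of `x`, so `v̄(root x) = v̄(x)` and `g_{U^{v̄}} = v̄·g_U·v̄⁻¹` pointwise.
[cite: Balaban1985Variational, (181) p.307] -/
theorem rootGauge_gaugeAct_blockLift {k : ℕ} (hk : k ≤ P.m + P.K) (v : GaugeTransf P k G) (U : GaugeField P 0 G) :
    rootGauge k (gaugeAct (blockLift k v) U) = gaugeAct (blockLift k v) (rootGauge k U) := by
  unfold rootGauge
  rw [← gaugeAct_mul, ← gaugeAct_mul]
  congr 1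
  funext x
  show rootTransporter k (gaugeAct (blockLift k v) U) x * blockLift k v x = blockLift k v x * rootTransporter k U x
  rw [rootTransporter_gaugeAct, show blockLift k v (rootOf k x) = blockLift k v x from by
    show v (blockIter k (rootOf k x)) = v (blockIter k x); rw [blockIter_rootOf hk], inv_mul_cancel_right]

end Rooted

/-! ## §2b  Measurability of the rooted gauge (any measurable group; `SU(N)` by instance) -/

section Measurable

variable {P : Params} {G : Type*} [GaugeGroup G] [MeasurableSpace G] [MeasurableMul₂ G] [MeasurableInv G]

omit [GaugeGroup G] [MeasurableMul₂ G] [MeasurableInv G] in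
/-- Each bond variable is a measurable function of the configuration (product σ-algebra of `Setup`). [cite: Balaban1987RG1, (0.21) p.256 (bookkeeping)] -/
private theorem measurable_apply' {j : ℕ} (b : PBond P j) : Measurable fun U : GaugeField P j G => U b :=
  measurable_pi_apply b

omit [MeasurableInv G] in
/-- Line holonomies are measurable in `U`. [cite: Balaban1987RG1, (0.21) p.256 (bookkeeping)] -/
theorem measurable_lineHol {j : ℕ} (a : Site P j) (μ : Fin P.d) : ∀ n, Measurable fun U : GaugeField P j G => lineHol U a μ n
  | 0 => measurable_const
  | n + 1 => (measurable_lineHol a μ n).mul (measurable_apply' _)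

omit [MeasurableInv G] in
/-- Path holonomies are measurable in `U`. [cite: Balaban1987RG1, (0.21) p.256 (bookkeeping)] -/
theorem measurable_pathHol {j : ℕ} : ∀ (a x : Site P j) (l : List (Fin P.d)), Measurable fun U : GaugeField P j G => pathHol U a x l
  | _, _, [] => measurable_const
  | a, x, μ :: l => (measurable_lineHol a μ _).mul (measurable_pathHol _ x l)

omit [MeasurableInv G] in
/-- The rooted transporter at a site is measurable in `U`. [cite: Balaban1987RG1, (0.21) p.256 (bookkeeping)] -/
theorem measurable_rootTransporter_apply (k : ℕ) (x : Site P 0) : Measurable fun U : GaugeField P 0 G => rootTransporter k U x :=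
  measurable_pathHol _ _ _

/-- **The rooted gauge `U ↦ U^{g_U}` is a MEASURABLE self-map of the configuration space.** [cite: Balaban1987RG1, (0.21) p.256 (bookkeeping)] -/
theorem measurable_rootGauge (k : ℕ) : Measurable (rootGauge k : GaugeField P 0 G → GaugeField P 0 G) := by
  refine measurable_pi_lambda _ fun b => ?_
  exact ((measurable_rootTransporter_apply k b.src).mul (measurable_apply' b)).mul (measurable_rootTransporter_apply k b.tgt).inv

end Measurable

end Literature.MathematicalPhysics.QuantumFieldTheory.Balaban1983to89.T4RootedResidualGauge

end
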